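/-
Copyright (c) 2026. Released under Apache 2.0 license.
-/
import Summits.RiemannHypothesis.RiemannHypothesis.Theorems.MotivicDoorSemilocalQuinticCells
import Summits.RiemannHypothesis.RiemannHypothesis.Theorems.MotivicDoorSemilocalMollify
import Summits.RiemannHypothesis.RiemannHypothesis.Theorems.MotivicDoorSemilocalThreshold
import HarnessLib

/-!
# Motivic door, semi-local ladder — rung R3⁻(0.59): `W_{∞,2}` fails on `C(a)` for every `a ≥ 0.59`

Pub speedrun, cell `pub-rhdoor`, ladder seat `lad-2`, generation 4 — the CLOSING file of the
rung.  Honest framing (cell charter): *lottery ticket at the motivic door; RH probability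
negligible; consolation prizes are real: a new semi-local Weil-positivity theorem, or a located
gap in the Connes–Consani programme, plus the ff-door theorem.*  This rung is a consolation prize
of the first kind, on the NEGATIVE side: it nearly closes the window left by generations 1–3.

MAIN THEOREMS (PROVED, sorry-free, standard axioms):

* `not_weilSemilocalPositivityOn_two_of_le`:
  `∀ a ≥ 59/100, ¬ WeilSemilocalPositivityOn {2} a` — the semi-local Weil form at `S = {∞, 2}`
  takes a negative value on a test function supported in `[-a, a]`;
* `weilSemilocalThreshold_two_lt : a*({2}) < 0.59`, and with generation 3's lower bound
  `weilSemilocalThreshold_two_mem_Ico'`: **`a*({2}) ∈ [563/1024, 59/100) = [0.5498, 0.59)`**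
  (DATA, not used in any proof: `a*({2}) = 0.5578…`, the window of ignorance is now `0.04` wide,
  down from `0.143`);
* `not_weilSemilocalPositivityOn_of_le`: the same for every finite `S` with `2 ∈ S ∌ 3`.

PROOF.  Markov form of `Re W_{∞,2}` (`MotivicDoorSemilocalMarkov`) + negativity criterion for
bounded odd a.e.-continuous witnesses via mollification (`MotivicDoorSemilocalMollify`) + the odd
quintic witness `G = p(x/b)1_{[-b,b]}`, `b = 0.589` with its exact increment polynomial
(`…QuinticWitness`) + elementary majorants of the archimedean density (`…QuinticDensity`) +
cell / tail / constant estimates (`…QuinticCells`) + kernel-checked interval arithmetic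
(`…QuinticKernel`, `decide +kernel`).  The certified inequality is
`(log 2/√2) D_{log 2}(G) + ∫₀^∞ w D(G) ≤ 1217.85 < 1226.87 ≤ C₂ ‖G‖²` (DATA, not used: true values `1217.04 / 1227.11`).

WHERE generation 3 stopped / WHY: its window `[0.5498, log 2)` came from a Jensen single-sine
majorant, which loses `≥ 0.08 ‖g‖²` below `log 2` and cannot cross `≈ 0.65`; the Markov form has no
loss, and polynomial witnesses make every cell integral an exact rational.
-/

set_option linter.dupNamespace false

noncomputable section

open MeasureTheory Set Filter Topology Real Finset
open Literature.NumberTheory.LFunctions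
open Literature.Analysis.ValidatedNumerics.Numerics

namespace Summit.RiemannHypothesis.RiemannHypothesis.Theorems.MotivicDoor.SemilocalQuintic

open SemilocalMarkov SemilocalKernel SemilocalThreshold Semilocal

/-! ## The bulk `0 < t ≤ 2b` -/

/-- `∫_{(0,2b]} w D = Σ_{i<2356} ∫_{a_i}^{a_{i+1}} w D`. -/
theorem integral_Ioc_eq_sum :
    ∫ t in Ioc 0 (2 * bQ), weilArchDensity t * weilIncrement GQ t
      = ∑ i ∈ range 2356, ∫ t in ag i..ag (i + 1), weilArchDensity t * weilIncrement GQ t := by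
  rw [intervalIntegral.sum_integral_adjacent_intervals, ag_zero, ag_last,
    intervalIntegral.integral_of_le (by have := bQ_pos; positivity)]
  intro k _
  have hk0 : 0 ≤ ag k := by unfold ag; positivity
  have hle : ag k ≤ ag (k + 1) := by unfold ag; push_cast; linarith
  exact (intervalIntegrable_iff_integrableOn_Ioc_of_le hle).2
    (integrableOn_w_mul_weilIncrement_GQ.mono_set fun t ht ↦ lt_of_le_of_lt hk0 ht.1)

/-- A block of `n` cells starting at `i₀ ≥ 1` is bounded by `2b² chunkR i₀ n`. -/
theorem sum_cells_le {i0 n : ℕ} (h1 : 1 ≤ i0) (h2 : i0 + n ≤ 2356) :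
    ∑ k ∈ range n, ∫ t in ag (i0 + k)..ag (i0 + k + 1), weilArchDensity t * weilIncrement GQ t
      ≤ 2 * bQ ^ 2 * chunkR i0 n := by
  rw [chunkR_eq_sum, Finset.mul_sum]
  exact Finset.sum_le_sum fun k hk ↦
    cell_le (by omega) (by have := Finset.mem_range.1 hk; omega)

/-- The bulk: `∫_{(0,2b]} w D ≤ 0.0336 + 2b² (B1 + B2 + B3)/2^48`. -/
theorem bulk_integral_le :
    ∫ t in Ioc 0 (2 * bQ), weilArchDensity t * weilIncrement GQ t
      ≤ 336 / 10000 + 2 * bQ ^ 2 * (((B1 + B2 + B3 : ℤ) : ℝ) / SC) := by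
  rw [integral_Ioc_eq_sum]
  set F : ℕ → ℝ := fun i ↦ ∫ t in ag i..ag (i + 1), weilArchDensity t * weilIncrement GQ t
    with hF
  have s1 : ∑ i ∈ range 2356, F i = ∑ i ∈ range 1571, F i + ∑ k ∈ range 785, F (1571 + k) :=
    Finset.sum_range_add F 1571 785
  have s2 : ∑ i ∈ range 1571, F i = ∑ i ∈ range 786, F i + ∑ k ∈ range 785, F (786 + k) :=
    Finset.sum_range_add F 786 785
  have s3 : ∑ i ∈ range 786, F i = ∑ i ∈ range 1, F i + ∑ k ∈ range 785, F (1 + k) :=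
    Finset.sum_range_add F 1 785
  rw [s1, s2, s3, Finset.sum_range_one]
  have h0 : F 0 ≤ 336 / 10000 := cell_zero_le
  have hc1 : ∑ k ∈ range 785, F (1 + k) ≤ 2 * bQ ^ 2 * chunkR 1 785 :=
    sum_cells_le le_rfl (by norm_num)
  have hc2 : ∑ k ∈ range 785, F (786 + k) ≤ 2 * bQ ^ 2 * chunkR 786 785 :=
    sum_cells_le (by norm_num) (by norm_num)
  have hc3 : ∑ k ∈ range 785, F (1571 + k) ≤ 2 * bQ ^ 2 * chunkR 1571 785 :=
    sum_cells_le (by norm_num) (by norm_num)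
  have hb2 : (0 : ℝ) ≤ 2 * bQ ^ 2 := mul_nonneg zero_le_two (sq_nonneg bQ)
  have hb3 := mul_le_mul_of_nonneg_left bulk_le hb2
  -- (no `linarith` here: its preprocessing would expand the 2356-term sums in context)
  calc F 0 + ∑ k ∈ range 785, F (1 + k) + ∑ k ∈ range 785, F (786 + k)
        + ∑ k ∈ range 785, F (1571 + k)
      ≤ 336 / 10000 + 2 * bQ ^ 2 * chunkR 1 785 + 2 * bQ ^ 2 * chunkR 786 785
        + 2 * bQ ^ 2 * chunkR 1571 785 := add_le_add (add_le_add (add_le_add h0 hc1) hc2) hc3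
    _ = 336 / 10000 + 2 * bQ ^ 2 * (chunkR 1 785 + chunkR 786 785 + chunkR 1571 785) := by ring
    _ ≤ _ := add_le_add le_rfl hb3

/-! ## The certified inequality -/

/-- `log 2 / √2 ≤ 0.4901291`. -/
theorem log_two_div_sqrt_two_le : Real.log 2 / Real.sqrt 2 ≤ 4901291 / 10000000 := by
  have hs : (1.41421356 : ℝ) ≤ Real.sqrt 2 := by
    rw [show (1.41421356 : ℝ) = Real.sqrt (1.41421356 ^ 2) by rw [Real.sqrt_sq (by norm_num)]]
    exact Real.sqrt_le_sqrt (by norm_num)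
  have hs0 : 0 < Real.sqrt 2 := by positivity
  rw [div_le_iff₀ hs0]
  have := Real.log_two_lt_d9
  nlinarith

/-- **The certified Markov inequality for the quintic witness**:
`(log 2/√2) D_{log 2}(G) + ∫₀^∞ w D(G) < C₂ ‖G‖²`. -/
theorem arch_lt :
    Real.log 2 / Real.sqrt 2 * weilIncrement GQ (Real.log 2)
      + (∫ t in Ioi (0 : ℝ), weilArchDensity t * weilIncrement GQ t)
      < semilocalTwoConstant * ∫ x, ‖GQ x‖ ^ 2 := by
  have hb := bQ_pos
  have hl1 := Real.log_two_gt_d9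
  have hl2 := Real.log_two_lt_d9
  have hSC := SC_pos
  -- D(log 2)
  have hD : weilIncrement GQ (Real.log 2) ≤ 2 * bQ * ((BD : ℝ) / SC) := by
    rw [weilIncrement_GQ_eq (by linarith) (by unfold bQ; linarith)]
    refine mul_le_mul_of_nonneg_left ?_ (by positivity)
    have h := hornerR_dL_log_two_le
    rw [hornerR_eq_polyR, kernel_dL] at h
    exact h
  have h1 : Real.log 2 / Real.sqrt 2 * weilIncrement GQ (Real.log 2)
      ≤ 4901291 / 10000000 * (2 * bQ * ((BD : ℝ) / SC)) :=
    mul_le_mul log_two_div_sqrt_two_le hD (weilIncrement_nonneg _ _) (by norm_num)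
  -- split the integral
  have hfin := integrableOn_w_mul_weilIncrement_GQ
  have hI : ∫ t in Ioi (0 : ℝ), weilArchDensity t * weilIncrement GQ t
      = (∫ t in Ioc 0 (2 * bQ), weilArchDensity t * weilIncrement GQ t)
        + ∫ t in Ioi (2 * bQ), weilArchDensity t * weilIncrement GQ t := by
    rw [← setIntegral_union Ioc_disjoint_Ioi_same measurableSet_Ioi
      (hfin.mono_set Ioc_subset_Ioi_self) (hfin.mono_set (Ioi_subset_Ioi (by positivity))),
      Ioc_union_Ioi_eq_Ioi (by positivity)]
  have h2 := bulk_integral_le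
  have hN2 : 0 ≤ 2 * NQ := by unfold NQ n2Q bQ; norm_num
  have hT : tailT (Real.exp (-bQ)) ≤ (BT : ℝ) / SC := by unfold bQ; exact tailT_le
  have h3 : ∫ t in Ioi (2 * bQ), weilArchDensity t * weilIncrement GQ t ≤ 2 * NQ * ((BT : ℝ) / SC) :=
    tail_le.trans (mul_le_mul_of_nonneg_left hT hN2)
  -- the constant
  have hC := const_le_semilocalTwoConstant
  have hK := kLo_le_kSum
  have hNQ : 0 ≤ NQ := by unfold NQ n2Q bQ; norm_num
  have h4 : (40884869 / 10000000 + 2 * ((KL : ℝ) / SC)) * NQ ≤ semilocalTwoConstant * NQ :=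
    mul_le_mul_of_nonneg_right (by linarith) hNQ
  have key : 4901291 / 10000000 * (2 * bQ * ((BD : ℝ) / SC))
      + ((336 / 10000 + 2 * bQ ^ 2 * (((B1 + B2 + B3 : ℤ) : ℝ) / SC)) + 2 * NQ * ((BT : ℝ) / SC))
      < (40884869 / 10000000 + 2 * ((KL : ℝ) / SC)) * NQ := by
    simp only [bQ, NQ, n2Q, B1, B2, B3, BD, BT, KL, SC]
    push_cast
    norm_num
  rw [integral_norm_sq_GQ, hI]
  linarith

/-! ## The rung -/

/-- `W_{∞,2}` fails on `C(B)` for `0.589 < B ≤ log 2`. -/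
theorem not_weilSemilocalPositivityOn_two_of_lt {B : ℝ} (hbB : bQ < B) (hB : B ≤ Real.log 2) :
    ¬ WeilSemilocalPositivityOn ({2} : Finset ℕ) B :=
  isMarkovWitness_GQ.not_weilSemilocalPositivityOn_two integrableOn_w_mul_weilIncrement_GQ
    arch_lt hbB hB

/-- **Rung R3⁻(0.59).**  For every `a ≥ 0.59` the semi-local Weil form at `S = {∞, 2}` takes a
negative value on some test function supported in `[-a, a]`:
`¬ WeilSemilocalPositivityOn {2} a`.  (Below `log 2`: the quintic Markov certificate; at and above
`log 2`: generation 2's Jensen-window witness.) -/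
theorem not_weilSemilocalPositivityOn_two_of_le {a : ℝ} (ha : (59 / 100 : ℝ) ≤ a) :
    ¬ WeilSemilocalPositivityOn ({2} : Finset ℕ) a := by
  by_cases h : a ≤ Real.log 2
  · exact not_weilSemilocalPositivityOn_two_of_lt (lt_of_lt_of_le bQ_lt ha) h
  · exact not_weilSemilocalPositivityOn_two_of_log_two_le (le_of_not_ge h)

/-- The same for every finite set of places `S ∋ 2`, `3 ∉ S` (the `{∞,2}` form is the semi-local
form of every such `S` on `C(a)`, `a ≤ (log 5)/2`). -/
theorem not_weilSemilocalPositivityOn_of_le {S : Finset ℕ} (h2 : 2 ∈ S) (h3 : 3 ∉ S) {a : ℝ}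
    (ha : (59 / 100 : ℝ) ≤ a) : ¬ WeilSemilocalPositivityOn S a := by
  by_cases h : a ≤ Real.log 2
  · rw [weilSemilocalPositivityOn_iff_two h2 h3 (h.trans log_two_le_log_five_half)]
    exact not_weilSemilocalPositivityOn_two_of_le ha
  · exact not_weilSemilocalPositivityOn_of_log_two_le h2 h3 (le_of_not_ge h)

/-- **The threshold form of the rung**: `a*({2}) < 0.59`. -/
theorem weilSemilocalThreshold_two_lt : weilSemilocalThreshold {2} < 59 / 100 :=
  not_weilSemilocalPositivityOn_iff_weilSemilocalThreshold_lt.1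
    (not_weilSemilocalPositivityOn_two_of_le le_rfl)

/-- **Rung R3 as one number, generation 4**: `a*({2}) ∈ [563/1024, 59/100)`. -/
theorem weilSemilocalThreshold_two_mem_Ico' :
    weilSemilocalThreshold {2} ∈ Ico (((weilCert3C.b : ℚ) : ℝ)) (59 / 100) :=
  ⟨weilSemilocalThreshold_two_mem_Ico.1, weilSemilocalThreshold_two_lt⟩

/-- Decimal form: `0.5498 ≤ a*({2}) < 0.59` (PROVED; DATA, not used: `a*({2}) = 0.5578…`). -/
theorem weilSemilocalThreshold_two_bounds' :
    (0.5498 : ℝ) ≤ weilSemilocalThreshold {2} ∧ weilSemilocalThreshold {2} < 0.59 :=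
  ⟨weilSemilocalThreshold_two_bounds.1, by have := weilSemilocalThreshold_two_lt; norm_num at this ⊢; exact this⟩

/-- For every finite `S` with `2 ∈ S ∌ 3`: `a*(S) < 0.59`. -/
theorem weilSemilocalThreshold_lt_of_two_three {S : Finset ℕ} (h2 : 2 ∈ S) (h3 : 3 ∉ S) :
    weilSemilocalThreshold S < 59 / 100 := by
  rw [weilSemilocalThreshold_eq_two h2 h3]; exact weilSemilocalThreshold_two_lt

end Summit.RiemannHypothesis.RiemannHypothesis.Theorems.MotivicDoor.SemilocalQuintic

end
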